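import Summits.QuantumFields.QCD.Theses.HeatSlicedQuarks
import Summits.QuantumFields.QCD.Theorems.GluonicCompletion.Negative.Threshold

/-!
# `RobustYangMillsHandover` — the two gap clauses separate; `¬`-form per flavour; threshold form
# of the antecedent (negative lane, cycle 2; definition-free)

Crux `stmt-QuantumFields-8892` of route `HeatSlicedQuarks` is the bare arrow
`RobustYangMillsHandover := ContinuumQCDExists → QCD`.  Companion of
`Negative/WithoutNontriviality.lean` (cycle 1) and of the standing disprover's workfile
`Cruxes/RobustYangMillsHandover/Disproof.lean` (§§6–8, where the same facts carry names:
`HandoverSameReg`, `SameRegContinuumGap`, `SameRegLatticeGap`, `ContinuumQCDExistsAbove`).  Pure logic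
over the tree's definitions, kernel-checked:

* `hasLatticeMassGap_scheme_indep` — the lattice gap clause of `QCDOf` never reads the species data
  `z, shift` (nor `T`); with the monotonicity lemmas `hasMassGap_anti`, `hasLatticeMassGap_anti` this
  gives `gapClauses_split`: at fixed `(reg, m)` the conclusion "∃ z shift T, … ∧ ∃ Δ > 0, both gaps"
  is EQUIVALENT to "(∃ z shift T, … ∧ ∃ Δ > 0, continuum gap) ∧ (∃ Δ > 0, lattice gap of
  `reg.scheme m 0 0`)" — for a prover who keeps X₀'s regularisation the lattice half is a statement
  about lattice QCD along the bare trajectory alone, to which the handed-over continuum data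
  contribute nothing.
* `not_qcd_of_not_handover`, `not_handover_iff`, `not_handover_iff_perFlavour` — a refutation of the
  crux is exactly a construction of X₀ plus the failure of ONE of `QCDOf 2`, `QCDOf 3`.
* `continuumQCDExists_iff_threshold` — the X₀-twin of `qcdOf_iff_threshold`: the antecedent, too, only
  speaks about mass tuples above an unpinned offset (shift `m_crit(k) ↦ m_crit(k) + a_k M₀ / Z_m(k)`).

(cdisprove seat refuter-cdisprove-stmt-QuantumFields-8892-g2-0, 2026-08-16.)

Maintenance record (importer-rebuild repair 2026-08-17, after p134299 repaired the imported
`GluonicCompletion/Negative/Threshold.lean`): the Statement re-type of 2026-08-16T17:37 inserted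
`reg.IsChiralAtZero ∧` into `QCDOf`; `qcdOf_iff_split` spelled out the pre-retype shape on its right-hand
side and stopped elaborating (type mismatch at the `exists_congr` step). It is re-stated over the re-typed
`QCDOf` as `qcdOf_iff_split_chiral` (one more `and_congr_right`), the old name kept as a deprecated alias;
nothing else changed.
-/

namespace Summit.QuantumFields.QCD.Theorems.RobustYangMillsHandover.Negative

open Summit.QuantumFields.QCD.Theses.HeatSlicedQuarks
open Literature.MathematicalPhysics.QuantumFieldTheory
open Literature.MathematicalPhysics.AQFT
open Filter Topology

/-! ## The two gap clauses separate -/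

/-- The lattice gap clause does not see the species data `z, shift` (nor `T`): it reads only
`β_k, L_k, a_k, m_f(k)` of the scheme. [folklore] -/
theorem hasLatticeMassGap_scheme_indep {Nf : ℕ} (reg : QCDRegularisation Nf) (m : Fin Nf → ℝ)
    (z shift z' shift' : QCDField Nf → ℕ → ℝ) (Δ : ℝ) :
    (reg.scheme m z shift).HasLatticeMassGap Δ ↔ (reg.scheme m z' shift').HasLatticeMassGap Δ :=
  Iff.rfl

/-- `HasMassGap` is monotone: a gap `Δ'` is a gap `Δ ≤ Δ'`. [folklore] -/
theorem hasMassGap_anti {ι : Type} {d : ℕ} [NeZero d] (T : OSData ι d) {Δ Δ' : ℝ} (hle : Δ ≤ Δ')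
    (h : T.HasMassGap Δ') : T.HasMassGap Δ := by
  intro n m k k' F G hF hG
  obtain ⟨C, hC⟩ := h n m k k' F G hF hG
  refine ⟨C, fun t ht H hH => (hC t ht H hH).trans ?_⟩
  have hC0 : 0 ≤ C := by
    have h1 := (norm_nonneg _).trans (hC t ht H hH)
    exact nonneg_of_mul_nonneg_left h1 (Real.exp_pos _)
  exact mul_le_mul_of_nonneg_left (Real.exp_le_exp.mpr (by nlinarith)) hC0

/-- `HasLatticeMassGap` is monotone: a lattice gap `Δ'` is a lattice gap `Δ ≤ Δ'`. [folklore] -/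
theorem hasLatticeMassGap_anti {Nf : ℕ} (sch : QCDScheme Nf) {Δ Δ' : ℝ} (hle : Δ ≤ Δ')
    (h : sch.HasLatticeMassGap Δ') : sch.HasLatticeMassGap Δ := by
  intro R R' A B
  obtain ⟨C, hC⟩ := h R R' A B
  refine ⟨C, ?_⟩
  filter_upwards [hC] with k hk S hS n hn
  refine (hk S hS n hn).trans ?_
  have hC0 : 0 ≤ C := by
    have h1 := (norm_nonneg _).trans (hk S hS n hn)
    exact nonneg_of_mul_nonneg_left h1 (Real.exp_pos _)
  refine mul_le_mul_of_nonneg_left (Real.exp_le_exp.mpr ?_) hC0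
  have : 0 ≤ sch.a k * n := mul_nonneg (sch.a_pos k).le (Nat.cast_nonneg n)
  nlinarith

/-- **The two gap clauses separate (at fixed regularisation and masses).** For any property `P` of
the re-chosen data `(z, shift, T)` (in the crux: `IsQCDAlong ∧` the three non-triviality clauses),
"some `(z, shift, T)` with `P` and a COMMON `Δ > 0` gapping `T` and the lattice scheme" is equivalent
to "some `(z, shift, T)` with `P` and a continuum gap" AND "a lattice gap of `reg.scheme m 0 0`":
the lattice half never involves `T`. The common `Δ` is the minimum. [folklore] -/
theorem gapClauses_split {Nf : ℕ} (reg : QCDRegularisation Nf) (m : Fin Nf → ℝ)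
    (P : (QCDField Nf → ℕ → ℝ) → (QCDField Nf → ℕ → ℝ) → OSData (QCDField Nf) 4 → Prop) :
    (∃ (z shift : QCDField Nf → ℕ → ℝ) (T : OSData (QCDField Nf) 4), P z shift T ∧
        ∃ Δ > 0, T.HasMassGap Δ ∧ (reg.scheme m z shift).HasLatticeMassGap Δ) ↔
      (∃ (z shift : QCDField Nf → ℕ → ℝ) (T : OSData (QCDField Nf) 4), P z shift T ∧
          ∃ Δ > 0, T.HasMassGap Δ) ∧
        ∃ Δ > 0, (reg.scheme m 0 0).HasLatticeMassGap Δ := by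
  constructor
  · rintro ⟨z, shift, T, hP, Δ, hΔ, hT, hL⟩
    exact ⟨⟨z, shift, T, hP, Δ, hΔ, hT⟩, Δ, hΔ, (hasLatticeMassGap_scheme_indep reg m z shift 0 0 Δ).mp hL⟩
  · rintro ⟨⟨z, shift, T, hP, Δ₁, hΔ₁, hT⟩, Δ₂, hΔ₂, hL⟩
    refine ⟨z, shift, T, hP, min Δ₁ Δ₂, lt_min hΔ₁ hΔ₂, hasMassGap_anti T (min_le_left _ _) hT, ?_⟩
    exact (hasLatticeMassGap_scheme_indep reg m 0 0 z shift _).mp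
      (hasLatticeMassGap_anti _ (min_le_right _ _) hL)

/-- **`QCDOf`, split.** The summit's per-flavour conclusion is: one regularisation with
`HasMassScaling`, CHIRAL AT ZERO renormalised mass (`IsChiralAtZero`, the conjunct added by the
Statement re-type of 2026-08-16T17:37 — the lattice gap closes as `m → 0⁺`, pinning the additive offset
of `m_crit`), such that for every positive mass tuple (a) some `(z, shift, T)` are QCD along the scheme,
non-trivial, non-Gaussian, non-decoupled AND continuum-gapped, and (b) lattice QCD along the bare
trajectory (species data irrelevant) is lattice-gapped. (Maintenance 2026-08-17: re-stated over the
re-typed `QCDOf`; the pre-retype name `qcdOf_iff_split`, whose spelled-out right-hand side lacked the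
chirality conjunct and stopped elaborating, is kept as a deprecated alias.) [folklore] -/
theorem qcdOf_iff_split_chiral (Nf : ℕ) : QCDOf Nf ↔
    ∃ reg : QCDRegularisation Nf, reg.HasMassScaling ∧ reg.IsChiralAtZero ∧
      ∀ m : Fin Nf → ℝ, (∀ f, 0 < m f) →
      (∃ (z shift : QCDField Nf → ℕ → ℝ) (T : OSData (QCDField Nf) 4),
          (IsQCDAlong (reg.scheme m z shift) T ∧ T.IsNontrivial QCDField.glue ∧
            T.IsNonGaussian QCDField.glue ∧
              ∀ f g : Fin Nf, f ≠ g → T.IsNontrivial (QCDField.pseudoRe f g)) ∧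
            ∃ Δ > 0, T.HasMassGap Δ) ∧
        ∃ Δ > 0, (reg.scheme m 0 0).HasLatticeMassGap Δ := by
  refine exists_congr fun reg => and_congr_right fun _ => and_congr_right fun _ =>
    forall₂_congr fun m _ => ?_
  rw [← gapClauses_split reg m (fun z shift T => IsQCDAlong (reg.scheme m z shift) T ∧
    T.IsNontrivial QCDField.glue ∧ T.IsNonGaussian QCDField.glue ∧
      ∀ f g : Fin Nf, f ≠ g → T.IsNontrivial (QCDField.pseudoRe f g))]
  constructor
  · rintro ⟨z, shift, T, hA, hN, hG, hP, hgap⟩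
    exact ⟨z, shift, T, ⟨hA, hN, hG, hP⟩, hgap⟩
  · rintro ⟨z, shift, T, ⟨hA, hN, hG, hP⟩, hgap⟩
    exact ⟨z, shift, T, hA, hN, hG, hP, hgap⟩

/-- DEPRECATED pre-retype name (its spelled-out right-hand side lacked `reg.IsChiralAtZero` and stopped
elaborating with the Statement re-type of 2026-08-16T17:37). [folklore] -/
@[deprecated qcdOf_iff_split_chiral (since := "2026-08-17")]
alias qcdOf_iff_split := qcdOf_iff_split_chiral

/-! ## The `¬`-form, per flavour -/

/-- Any refutation of the crux refutes the summit conjunct (the crux is implied by `QCD`).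
[folklore] -/
theorem not_qcd_of_not_handover : ¬ RobustYangMillsHandover → ¬ _root_.QCD :=
  fun h q => h fun _ => q

/-- A refutation of the crux is EXACTLY a construction of X₀ together with a refutation of `QCD`.
[folklore] -/
theorem not_handover_iff : ¬ RobustYangMillsHandover ↔ ContinuumQCDExists ∧ ¬ _root_.QCD :=
  Classical.not_imp

/-- … and a refutation of `QCD` is the failure of ONE of its flavour components, while the antecedent
must be supplied for BOTH. [folklore] -/
theorem not_handover_iff_perFlavour :
    ¬ RobustYangMillsHandover ↔ ContinuumQCDExists ∧ (¬ QCDOf 2 ∨ ¬ QCDOf 3) := by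
  rw [not_handover_iff]
  refine and_congr_right fun _ => ?_
  constructor
  · intro hQ
    by_contra h
    obtain ⟨h2, h3⟩ := not_or.mp h
    exact hQ ⟨not_not.mp h2, not_not.mp h3⟩
  · intro hQ q
    exact hQ.elim (fun h => h q.1) (fun h => h q.2)

/-! ## Threshold form of the antecedent -/

/-- **Threshold reading of the antecedent** (the X₀-twin of `qcdOf_iff_threshold`): X₀ is
equivalent to its restriction to mass tuples above a witness-dependent offset `M₀ ≥ 0` — shift
`m_crit(k) ↦ m_crit(k) + a_k M₀ / Z_m(k)`, which changes neither `HasMassScaling` nor the scheme at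
the shifted masses. So hypothesis and conclusion of the crux both speak only above unpinned, mutually
independent offsets. [folklore] -/
theorem continuumQCDExists_iff_threshold : ContinuumQCDExists ↔
    ∀ Nf : ℕ, Nf = 2 ∨ Nf = 3 → ∃ M₀ : ℝ, 0 ≤ M₀ ∧ ∃ reg : QCDRegularisation Nf, reg.HasMassScaling ∧
      ∀ m : Fin Nf → ℝ, (∀ f, M₀ < m f) →
        ∃ (z shift : QCDField Nf → ℕ → ℝ) (T : OSData (QCDField Nf) 4),
          IsQCDAlong (reg.scheme m z shift) T ∧ T.IsNontrivial QCDField.glue ∧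
            T.IsNonGaussian QCDField.glue ∧
              ∀ f g : Fin Nf, f ≠ g → T.IsNontrivial (QCDField.pseudoRe f g) := by
  refine forall₂_congr fun Nf _ => ⟨?_, ?_⟩
  · rintro ⟨reg, hms, h⟩
    exact ⟨0, le_rfl, reg, hms, h⟩
  · rintro ⟨M₀, -, reg, hms, h⟩
    refine ⟨{ reg with mcrit := fun k => reg.mcrit k + reg.a k * M₀ / reg.Zm k }, hms, fun m hm => ?_⟩
    obtain ⟨z, shift, T, hQ, hN, hG, hP⟩ := h (fun f => M₀ + m f) (fun f => by linarith [hm f])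
    refine ⟨z, shift, T, ?_, hN, hG, hP⟩
    rwa [Theorems.GluonicCompletion.Negative.scheme_mcrit_shift]

end Summit.QuantumFields.QCD.Theorems.RobustYangMillsHandover.Negative
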